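import Summits.QuantumFields.YangMills.Theorems.SwapVirialDeficitSectorLaplaceTipCornerConcrete
import Summits.QuantumFields.YangMills.Theorems.SwapVirialDeficitSectorLaplaceTipCoreLayer
import HarnessLib

/-!
# THE TIP OF SKELETON ➎, THE CORE AGAINST THE BULK MAIN TERM FROM THE PROFILE CEILING (hCore) — concrete composition
# (cell ym-idea-1; free-hands support of ⟨stmt-QuantumFields-24197⟩ `SwapVirialDeficit.SwapGluedStiffness`; LEAD g99 (R2) 01:07Z ∕ g100 01:29Z and w3 g68 01:18Z:
# «(hCore) keeps the PROFILE (1+δt²)²∕(1+h(p)(1+δt²)) INSIDE the p-integral; the corner of the core is the integration layer's»)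

(hCore), per hub: `I(hubAt δt 1, ε; b) ≤ Φ·((2π/b)^α·∫_p Profile(δt,p)·𝔪(hubAt δs 1, ε, p)) + T`, `Profile = (1+δt²)²/(1 + h(p)(1+δt²))`,
`h(p) = x₀²/(1+x₀²) + y₀²/(1+y₀²)`, for `δt > d`, `δs` on the shell `[δr, 2δr]`.  The box `|p| ≥ ρ₁` carries `Profile ≤ 2(1+δt²)/ρ₁²`, the corner disc
`|p| < ρ₁` the structured profile (✓`setIntegral_disc_le_of_pointwise` after w2's oscillation built into ✓`mbDensity_hubAt_comparable_profile`), the letter `δt` the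
weights `(1+δt²)⁻¹` resp. `(1+δt²)^{−7/8}` (✓`setIntegral_inv_one_add_sq_le_inv`, ✓`integral_Ioi_inv_one_add_sq_mul_rpow_le`):
* ★ `core_le_shell_of_pointwise₂` — abstract twin of ✓`core_le_shell_of_pointwise` with the two weights `(1+δt²)` (box) and `(1+δt²)^{9/8}` (corner disc):
  `∫_{Ioi d}((1+δ²)⁻¹)²·I ≤ (Φ₁·d⁻¹ + Φ₂·(8/3)·d^{−3/4})/W₂·∫_{[a,c]}((1+δ²)⁻¹)²·P + T·d⁻¹` (`d ≥ 1`) — the `d⁻¹ ∕ d^{−3/4}`-RATES of the core (`d = δ_b(b) → ∞`).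
The concrete composition `tipCore_le_mbMain_of_profile` (box `Profile ≤ 2(1+δt²)/ρ₁²`, disc via ✓`setIntegral_disc_le_of_pointwise`, shell average) follows in the next file.

HONEST LABEL: composition bookkeeping; (hCore) (multi-seat: w3 g68, w2 g61, successors), `stub_core_tip`, ⟨24197⟩ ∕ ⟨24194⟩ OPEN; item of record ⟨24085⟩ `SubOctaveBounded`
aside ∕ untouched; the Yang–Mills mass gap is NOT proved; no summit is proved by a line.  THEOREMS ONLY (0 `def`, 0 `sorry`), standard axioms, no instances.
Seat ym-line-fcl-p3 g49 (cell ym-idea-1, free hands = ➎ assembler), `--supports stmt-QuantumFields-24197`.  References: [cite: Luscher1983, §2]; [folklore].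
-/

set_option autoImplicit false
set_option synthInstance.maxSize 1024

noncomputable section

open MeasureTheory Quaternion Set Module
open scoped Quaternion BigOperators ENNReal
open Literature.MathematicalPhysics.QuantumLattice
open Literature.MathematicalPhysics.QuantumFieldTheory hiding SU2
open Summit.QuantumFields.YangMills.Theorems.SwapTwistDeficit.ToronLog

namespace Summit.QuantumFields.YangMills.Theorems.SwapVirialDeficit.SectorLaplace

open Summit.QuantumFields.YangMills.Theorems.FemtoTransferGap
open Summit.QuantumFields.YangMills.Theorems.FemtoTransferGap.TT
open Summit.QuantumFields.YangMills.Theorems.VirialFluxGap.RingDeficit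
open Summit.QuantumFields.YangMills.Theorems.SwapVirialDeficit.SwapRing
open Summit.QuantumFields.YangMills.Theorems.SwapVirialDeficit.BlowUpRing

variable {L : ℕ} [NeZero L]

/-! ## §1 The abstract core layer with the two weights -/

omit [NeZero L] in
/-- ★ **CORE AGAINST SHELL, TWO WEIGHTS, abstract**: `I ≥ 0` on `Ioi d` (`d ≥ 1`), `P ≥ 0` on `Icc a c` (`1 ≤ a < c`) with `((1+δ²)⁻¹)²·P` integrable, `Φ₁, Φ₂, T ≥ 0`,
(hCore₂) `I δt ≤ (Φ₁·(1+δt²) + Φ₂·((1+δt²)·(1+δt²)^{1/8}))·P δs + T`.  Then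
`∫_{Ioi d}((1+δ²)⁻¹)²·I ≤ (Φ₁·d⁻¹ + Φ₂·(2·(4/3)·d^{−3/4}))/W₂·∫_{Icc a c}((1+δ²)⁻¹)²·P + T·d⁻¹`. [folklore] -/
theorem core_le_shell_of_pointwise₂ {I P : ℝ → ℝ} {d a c Φ₁ Φ₂ T : ℝ} (hd : 1 ≤ d) (ha : 1 ≤ a) (hac : a < c) (hΦ₁ : 0 ≤ Φ₁) (hΦ₂ : 0 ≤ Φ₂) (hT : 0 ≤ T)
    (hI0 : ∀ δ ∈ Ioi d, 0 ≤ I δ) (hP0 : ∀ δ ∈ Icc a c, 0 ≤ P δ)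
    (H : ∀ δt ∈ Ioi d, ∀ δs ∈ Icc a c, I δt ≤ (Φ₁ * (1 + δt ^ 2) + Φ₂ * ((1 + δt ^ 2) * (1 + δt ^ 2) ^ (1 / 8 : ℝ))) * P δs + T)
    (hS : IntegrableOn (fun δ => ((1 + δ ^ 2)⁻¹) ^ 2 * P δ) (Icc a c)) :
    ∫ δ in Ioi d, ((1 + δ ^ 2)⁻¹) ^ 2 * I δ ≤
      (Φ₁ * d⁻¹ + Φ₂ * (2 * (4 / 3) * d ^ (-(3 / 4 : ℝ)))) / ((c / (1 + c ^ 2) - a / (1 + a ^ 2) + (Real.arctan c - Real.arctan a)) / 2) *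
        (∫ δ in Icc a c, ((1 + δ ^ 2)⁻¹) ^ 2 * P δ) + T * d⁻¹ := by
  have hd0 : 0 < d := by linarith
  set W : ℝ := (c / (1 + c ^ 2) - a / (1 + a ^ 2) + (Real.arctan c - Real.arctan a)) / 2 with hW
  set B : ℝ := ∫ δ in Icc a c, ((1 + δ ^ 2)⁻¹) ^ 2 * P δ with hB
  have hWeq : ∫ x in Icc a c, ((1 + x ^ 2)⁻¹) ^ 2 = W := by rw [hW]; exact integral_Icc_inv_one_add_sq_sq hac.le
  have hW0 : 0 < W := by
    rw [← hWeq]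
    have hlow := integral_Icc_inv_one_add_sq_sq_ge ha hac.le
    have ha0 : 0 < a := by linarith
    have hc0 : 0 < c := by linarith
    have hlt : c⁻¹ ^ 3 < a⁻¹ ^ 3 := by
      have h1 : c⁻¹ < a⁻¹ := by rw [inv_lt_inv₀ hc0 ha0]; exact hac
      exact pow_lt_pow_left₀ h1 (inv_pos.2 hc0).le (by norm_num)
    linarith
  have hB0 : 0 ≤ B := by rw [hB]; exact setIntegral_nonneg measurableSet_Icc fun δ hδ => mul_nonneg (by positivity) (hP0 δ hδ)
  -- the weight function of the core letter
  set ω : ℝ → ℝ := fun δt => Φ₁ * (1 + δt ^ 2)⁻¹ + Φ₂ * ((1 + δt ^ 2)⁻¹ * (1 + δt ^ 2) ^ (1 / 8 : ℝ)) with hω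
  have hω0 : ∀ δt, 0 ≤ ω δt := fun δt => by
    rw [hω]; exact add_nonneg (mul_nonneg hΦ₁ (by positivity)) (mul_nonneg hΦ₂ (mul_nonneg (by positivity) (Real.rpow_nonneg (by positivity) _)))
  -- step 1: average over the shell letter
  have hstep : ∀ δt ∈ Ioi d, ((1 + δt ^ 2)⁻¹) ^ 2 * I δt * W ≤ ω δt * B + T * ((1 + δt ^ 2)⁻¹) ^ 2 * W := by
    intro δt hδt
    have hT1 : 0 < 1 + δt ^ 2 := by positivity
    have hsqI : ((1 + δt ^ 2)⁻¹) ^ 2 * ((Φ₁ * (1 + δt ^ 2) + Φ₂ * ((1 + δt ^ 2) * (1 + δt ^ 2) ^ (1 / 8 : ℝ)))) = ω δt := by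
      rw [hω]; field_simp
    have hpt : ∀ δs ∈ Icc a c, ((1 + δt ^ 2)⁻¹) ^ 2 * I δt * ((1 + δs ^ 2)⁻¹) ^ 2 ≤
        ω δt * (((1 + δs ^ 2)⁻¹) ^ 2 * P δs) + T * ((1 + δt ^ 2)⁻¹) ^ 2 * ((1 + δs ^ 2)⁻¹) ^ 2 := by
      intro δs hδs
      have h := H δt hδt δs hδs
      have hw : 0 ≤ ((1 + δs ^ 2)⁻¹) ^ 2 := by positivity
      have hwt : 0 ≤ ((1 + δt ^ 2)⁻¹) ^ 2 := by positivity
      have h2 := mul_le_mul_of_nonneg_left (mul_le_mul_of_nonneg_left h hwt) hw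
      have e : ((1 + δs ^ 2)⁻¹) ^ 2 * (((1 + δt ^ 2)⁻¹) ^ 2 * ((Φ₁ * (1 + δt ^ 2) + Φ₂ * ((1 + δt ^ 2) * (1 + δt ^ 2) ^ (1 / 8 : ℝ))) * P δs + T)) =
          (((1 + δt ^ 2)⁻¹) ^ 2 * (Φ₁ * (1 + δt ^ 2) + Φ₂ * ((1 + δt ^ 2) * (1 + δt ^ 2) ^ (1 / 8 : ℝ)))) * (((1 + δs ^ 2)⁻¹) ^ 2 * P δs) +
            T * ((1 + δt ^ 2)⁻¹) ^ 2 * ((1 + δs ^ 2)⁻¹) ^ 2 := by ring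
      rw [e, hsqI] at h2
      calc ((1 + δt ^ 2)⁻¹) ^ 2 * I δt * ((1 + δs ^ 2)⁻¹) ^ 2 = ((1 + δs ^ 2)⁻¹) ^ 2 * (((1 + δt ^ 2)⁻¹) ^ 2 * I δt) := by ring
        _ ≤ _ := h2
    have hinv : Continuous fun x : ℝ => (1 + x ^ 2)⁻¹ :=
      Continuous.inv₀ (f := fun x : ℝ => 1 + x ^ 2) (by fun_prop) (fun x => by show (1 + x ^ 2 : ℝ) ≠ 0; positivity)
    have hsq : IntegrableOn (fun δs : ℝ => ((1 + δs ^ 2)⁻¹) ^ 2) (Icc a c) := (hinv.pow 2).integrableOn_Icc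
    have hintL : IntegrableOn (fun δs : ℝ => ((1 + δt ^ 2)⁻¹) ^ 2 * I δt * ((1 + δs ^ 2)⁻¹) ^ 2) (Icc a c) := hsq.const_mul _
    have hintR : IntegrableOn (fun δs : ℝ => ω δt * (((1 + δs ^ 2)⁻¹) ^ 2 * P δs) + T * ((1 + δt ^ 2)⁻¹) ^ 2 * ((1 + δs ^ 2)⁻¹) ^ 2) (Icc a c) :=
      (hS.const_mul _).add (hsq.const_mul _)
    have hmono := setIntegral_mono_on hintL hintR measurableSet_Icc hpt
    rw [integral_const_mul, integral_add (hS.const_mul _) (hsq.const_mul _), integral_const_mul, integral_const_mul, hWeq, ← hB] at hmono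
    exact hmono
  -- step 2: divide by `W`, bound `((1+δt²)⁻¹)² ≤ (1+δt²)⁻¹` on the tail term, integrate over `Ioi d`
  have hpt2 : ∀ δt ∈ Ioi d, ((1 + δt ^ 2)⁻¹) ^ 2 * I δt ≤ (B / W) * ω δt + T * (1 + δt ^ 2)⁻¹ := by
    intro δt hδt
    have h := (le_div_iff₀ hW0).2 (hstep δt hδt)
    have h1 : (1 + δt ^ 2)⁻¹ ≤ 1 := inv_le_one_of_one_le₀ (by nlinarith [sq_nonneg δt])
    have h1' : 0 ≤ (1 + δt ^ 2)⁻¹ := by positivity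
    have hsq : ((1 + δt ^ 2)⁻¹) ^ 2 ≤ (1 + δt ^ 2)⁻¹ := by nlinarith
    calc ((1 + δt ^ 2)⁻¹) ^ 2 * I δt ≤ (ω δt * B + T * ((1 + δt ^ 2)⁻¹) ^ 2 * W) / W := h
      _ = (B / W) * ω δt + T * ((1 + δt ^ 2)⁻¹) ^ 2 := by field_simp
      _ ≤ (B / W) * ω δt + T * (1 + δt ^ 2)⁻¹ := by nlinarith [mul_le_mul_of_nonneg_left hsq hT]
  -- the explicit `δt`-integrals
  have hI1 : ∫ δ in Ioi d, (1 + δ ^ 2)⁻¹ ≤ d⁻¹ := setIntegral_inv_one_add_sq_le_inv hd0 (subset_refl _)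
  have hI2 : ∫ δ in Ioi d, (1 + δ ^ 2)⁻¹ * (1 + δ ^ 2) ^ (1 / 8 : ℝ) ≤ 2 * (4 / 3) * d ^ (-(3 / 4 : ℝ)) := integral_Ioi_inv_one_add_sq_mul_rpow_le hd
  have hint1 : IntegrableOn (fun δ : ℝ => (1 + δ ^ 2)⁻¹) (Ioi d) := integrable_inv_one_add_sq.integrableOn
  have hint2 : IntegrableOn (fun δ : ℝ => (1 + δ ^ 2)⁻¹ * (1 + δ ^ 2) ^ (1 / 8 : ℝ)) (Ioi d) := by
    -- dominated by `δ^{-7/4}` on `Ioi d`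
    have hdom : IntegrableOn (fun δ : ℝ => δ ^ (-(7 / 4) : ℝ)) (Ioi d) := integrableOn_Ioi_rpow_of_lt (by norm_num) hd0
    refine Integrable.mono' hdom ((Measurable.mul (by fun_prop) (Measurable.pow_const (by fun_prop) _)).aestronglyMeasurable) ?_
    filter_upwards [ae_restrict_mem measurableSet_Ioi] with δ hδ
    have hδ0 : 0 < δ := hd0.trans hδ
    have h1 : 0 < 1 + δ ^ 2 := by positivity
    rw [Real.norm_eq_abs, abs_of_nonneg (by positivity)]
    have e1 : (1 + δ ^ 2)⁻¹ * (1 + δ ^ 2) ^ (1 / 8 : ℝ) = (1 + δ ^ 2) ^ (-(7 / 8) : ℝ) := by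
      rw [← Real.rpow_neg_one, ← Real.rpow_add h1]; norm_num
    have e2 : δ ^ (-(7 / 4) : ℝ) = (δ ^ 2) ^ (-(7 / 8) : ℝ) := by
      rw [← Real.rpow_natCast δ 2, ← Real.rpow_mul hδ0.le]; norm_num
    rw [e1, e2]
    exact Real.rpow_le_rpow_of_nonpos (by positivity) (by nlinarith) (by norm_num)
  have hω' : IntegrableOn (fun δt : ℝ => ω δt) (Ioi d) := by
    rw [hω]; exact (hint1.const_mul Φ₁).add (hint2.const_mul Φ₂)
  have hintR : IntegrableOn (fun δt : ℝ => (B / W) * ω δt + T * (1 + δt ^ 2)⁻¹) (Ioi d) := (hω'.const_mul _).add (hint1.const_mul _)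
  have hmono2 : ∫ δ in Ioi d, ((1 + δ ^ 2)⁻¹) ^ 2 * I δ ≤ ∫ δ in Ioi d, ((B / W) * ω δ + T * (1 + δ ^ 2)⁻¹) := by
    refine integral_mono_of_nonneg ?_ hintR ?_
    · filter_upwards [ae_restrict_mem measurableSet_Ioi] with δ hδ using mul_nonneg (by positivity) (hI0 δ hδ)
    · filter_upwards [ae_restrict_mem measurableSet_Ioi] with δ hδ using hpt2 δ hδ
  have hωint : ∫ δ in Ioi d, ω δ = Φ₁ * (∫ δ in Ioi d, (1 + δ ^ 2)⁻¹) + Φ₂ * (∫ δ in Ioi d, (1 + δ ^ 2)⁻¹ * (1 + δ ^ 2) ^ (1 / 8 : ℝ)) := by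
    rw [hω]
    rw [integral_add (hint1.const_mul Φ₁) (hint2.const_mul Φ₂), integral_const_mul, integral_const_mul]
  have hsum : ∫ δ in Ioi d, ((B / W) * ω δ + T * (1 + δ ^ 2)⁻¹) = (B / W) * (∫ δ in Ioi d, ω δ) + T * (∫ δ in Ioi d, (1 + δ ^ 2)⁻¹) := by
    rw [integral_add (hω'.const_mul _) (hint1.const_mul T), integral_const_mul, integral_const_mul]
  rw [hsum, hωint] at hmono2
  have hBW : 0 ≤ B / W := by positivity
  have h1 := mul_le_mul_of_nonneg_left hI1 hΦ₁
  have h2 := mul_le_mul_of_nonneg_left hI2 hΦ₂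
  have h3 := mul_le_mul_of_nonneg_left hI1 hT
  have h4 := mul_le_mul_of_nonneg_left (add_le_add h1 h2) hBW
  calc ∫ δ in Ioi d, ((1 + δ ^ 2)⁻¹) ^ 2 * I δ
      ≤ B / W * (Φ₁ * (∫ δ in Ioi d, (1 + δ ^ 2)⁻¹) + Φ₂ * (∫ δ in Ioi d, (1 + δ ^ 2)⁻¹ * (1 + δ ^ 2) ^ (1 / 8 : ℝ))) + T * (∫ δ in Ioi d, (1 + δ ^ 2)⁻¹) := hmono2
    _ ≤ B / W * (Φ₁ * d⁻¹ + Φ₂ * (2 * (4 / 3) * d ^ (-(3 / 4 : ℝ)))) + T * d⁻¹ := add_le_add h4 h3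
    _ = (Φ₁ * d⁻¹ + Φ₂ * (2 * (4 / 3) * d ^ (-(3 / 4 : ℝ)))) / W * B + T * d⁻¹ := by field_simp

end Summit.QuantumFields.YangMills.Theorems.SwapVirialDeficit.SectorLaplace

end
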